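import Summits.BirchSwinnertonDyer.BirchSwinnertonDyer.Theses.TameQuarticManinParity
import Summits.BirchSwinnertonDyer.BirchSwinnertonDyer.Theorems.TameQuarticManinParityTorsionRepRigidOfCongruentFrobenius
import Summits.BirchSwinnertonDyer.BirchSwinnertonDyer.Theorems.TameQuarticManinParityCongruentNewformCarriesTorsionRepOfEverywhere
import Summits.BirchSwinnertonDyer.BirchSwinnertonDyer.Theorems.TameQuarticManinParityGammaOneNewformsFinite
import Summits.BirchSwinnertonDyer.BirchSwinnertonDyer.Theorems.TameQuarticManinParityNewformCoeffPrimesOverFinite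
import HarnessLib

/-!
# Route `TameQuarticManinParity`: CONG∞ (stmt-BirchSwinnertonDyer-23841) and CONG33 (stmt-23817) CONDITIONAL on Deligne's
# named fact `thm61` ONLY — the «_of_thm61» corollaries of LINE 34 / LINE 35

Seat `bsd-line-ttd-p1` g12 (explicit-unit on the planner-of-record's TQMP LINES 34/35, bsd-idea-3 g10; critic VERDICT #216
ruling (1): CONG∞ is landed ONLY in the «_of_thm61» shape, `--supports`, never as a close while `thm61` is a named fact).
With X35 (p684226), the LINE 35 glue R35 / RIG35 / G35 (`TameQuarticManinParityTorsionRepRigidOfCongruentFrobenius`) and the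
LINE 34 leaves FIN34a / FIN34b / glue G34 (cruxlead-23367 g2: p683734, p684039, p681685) all LANDED:

* `torsionRepOfEverywhereCongruentNewform_of_thm61 : DeligneSerre1974.thm61_exists_adicGaloisRep → TorsionRepOfEverywhereCongruentNewform`
  — CONG∞ (stmt-23841) modulo the ONE named Literature fact `thm61` (Deligne 1971: the λ-adic representation of a weight-2
  newform at EVERY finite place; the tree's `exists_padicGaloisRep_of_isNewform1` gives one place per `ℓ` and does not suffice);
* `tprimeIrrCongruentNewformCarriesTorsionRep_of_thm61 : DeligneSerre1974.thm61_exists_adicGaloisRep → TprimeIrrCongruentNewformCarriesTorsionRep`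
  — CONG33 (stmt-23817) modulo the same single fact (G34 ∘ FIN34a ∘ FIN34b ∘ CONG∞).

Both items stay OPEN (conditional results, `proof.conditional`).  THEOREMS ONLY: no definition, no named fact, no `sorry`.
No summit is proved; BSD is NOT proved; MS (stmt-23367) and the organ (stmt-24498) remain OPEN.
-/

set_option autoImplicit false
-- D-0017: single-problem summit, so `Summit.BirchSwinnertonDyer.BirchSwinnertonDyer.…` repeats a namespace BY DESIGN.
set_option linter.dupNamespace false

noncomputable section

namespace Summit.BirchSwinnertonDyer.BirchSwinnertonDyer.Theorems.TameQuarticManinParity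

open Summit.BirchSwinnertonDyer.BirchSwinnertonDyer.Theses.TameQuarticManinParity

/-- **CONG∞ `TorsionRepOfEverywhereCongruentNewform` (stmt-BirchSwinnertonDyer-23841) CONDITIONAL on Deligne's theorem only**:
an everywhere-congruent `Γ₁(M′)`-newform carries `ρ̄_{W,3} ⊗ k`, granted the named fact
`DeligneSerre1974.thm61_exists_adicGaloisRep` — the landed glue G35 (`torsionRepOfEverywhereCongruentNewform_of_rigid`) applied to
the PROVED RIG35 (`torsionRepRigidOfCongruentFrobenius_proof`).  The item stays open (conditional result).
[cite: DeligneSerreASENS1974, Thm. 6.1] -/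
theorem torsionRepOfEverywhereCongruentNewform_of_thm61
    (h61 : Literature.NumberTheory.EllipticCurves.ModularForms.DeligneSerre1974.thm61_exists_adicGaloisRep) :
    TorsionRepOfEverywhereCongruentNewform :=
  torsionRepOfEverywhereCongruentNewform_of_rigid h61 torsionRepRigidOfCongruentFrobenius_proof

/-- **CONG33 `TprimeIrrCongruentNewformCarriesTorsionRep` (stmt-BirchSwinnertonDyer-23817) CONDITIONAL on Deligne's theorem
only**: the finite separating set of congruence primes, from the landed LINE 34 glue G34
(`congruentNewformCarriesTorsionRep_of_everywhere`, «the separating set is free») fed with the PROVED leaves FIN34a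
(`gammaOneNewformsFinite_proof`), FIN34b (`newformCoeffPrimesOverFinite_proof`) and CONG∞ modulo `thm61`
(`torsionRepOfEverywhereCongruentNewform_of_thm61`).  The item stays open (conditional result).
[cite: DeligneSerreASENS1974, Thm. 6.1] -/
theorem tprimeIrrCongruentNewformCarriesTorsionRep_of_thm61
    (h61 : Literature.NumberTheory.EllipticCurves.ModularForms.DeligneSerre1974.thm61_exists_adicGaloisRep) :
    TprimeIrrCongruentNewformCarriesTorsionRep :=
  congruentNewformCarriesTorsionRep_of_everywhere gammaOneNewformsFinite_proof newformCoeffPrimesOverFinite_proof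
    (torsionRepOfEverywhereCongruentNewform_of_thm61 h61)

end Summit.BirchSwinnertonDyer.BirchSwinnertonDyer.Theorems.TameQuarticManinParity

end
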